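import Mathlib

set_option linter.dupNamespace false

/-!
SOLO-BLIND MatrixMultiplication (s73) — THE VALUE-FRAME LEMMA (KraftK3 §7.14, Lemma K3.14.2).

Setting of the Kraft–(K₃) programme: a system of `r` quadratic forms `Q_1, …, Q_r` on `V = Fⁿ` (for (K₃): `F = 𝔽₃`),
and *frames* = bases `v_1, …, v_n` of `V`.  The GRADED CRITERION of §7.14 says that a frame whose square-free
products span `F[x]/(x_i³, Q_j)` is universal (good on every affine level set of `Q + ℓ`); its degree-2 part is
exactly the condition that the VALUE VECTORS `(Q_1(v_i), …, Q_r(v_i)) ∈ Fʳ`, `i = 1 … n`, are linearly independent.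

This file proves, unconditionally and over any field with `2 ≠ 0`, that such frames always exist as soon as
`n ≤ r` and the value vectors of all points span `Fʳ` (equivalently: the `Q_j` are linearly independent as
functions, `span_valueVec_eq_top_of_linearIndependent`):

* `exists_valueFrame` — there is a linearly independent family `v : Fin n → Fⁿ` (hence a basis,
  `exists_valueFrame_span_top`) whose value vectors are linearly independent.

The only property of the `Q_j` used is the parallelogram law `Q(u+w) + Q(u−w) = 2Q(u) + 2Q(w)`, which every
quadratic form `x ↦ B(x,x)` (`B` bilinear) satisfies (`parallelogram_of_bilin`).  Proof: greedy extension — if a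
partial frame `v_1 … v_k` (`k < n ≤ r`) cannot be extended, every vector outside `U = span(v_i)` has its value
vector in `L = span(value vectors)`, and the parallelogram law applied to `u ± w₀` (`u ∈ U`, `w₀ ∉ U`) puts the value
vector of every `u ∈ U` in `L` as well; so `L = Fʳ`, contradicting `dim L ≤ k < r`.
No finiteness of `F` is needed.  Specialisation to `𝔽₃`: `exists_valueFrame_zmod3`.
-/

namespace Summit.MatrixMultiplication.MatrixMultiplication.Theorems

open Submodule

variable {F : Type*}

/-- The value vector `(Q_1(v), …, Q_r(v))` of a family of `r` functions at a point `v`. -/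
def valueVec {V : Type*} {r : ℕ} (Q : Fin r → V → F) (v : V) : Fin r → F := fun j => Q j v

/-- Unfolding lemma for `valueVec`. -/
@[simp] theorem valueVec_apply {V : Type*} {r : ℕ} (Q : Fin r → V → F) (v : V) (j : Fin r) :
    valueVec Q v j = Q j v := rfl

variable [Field F]

/-- The parallelogram law, in vector form, for the value vectors. -/
theorem valueVec_parallelogram {V : Type*} [AddCommGroup V] {r : ℕ} (Q : Fin r → V → F)
    (hpar : ∀ j u w, Q j (u + w) + Q j (u - w) = 2 * Q j u + 2 * Q j w) (u w : V) :
    valueVec Q (u + w) + valueVec Q (u - w) = (2 : F) • valueVec Q u + (2 : F) • valueVec Q w := by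
  funext j
  simp [hpar j u w]

/-- Every function of the form `x ↦ B x x` with `B` bilinear satisfies the parallelogram law. -/
theorem parallelogram_of_bilin {V : Type*} [AddCommGroup V] [Module F V] (B : V →ₗ[F] V →ₗ[F] F) (u w : V) :
    B (u + w) (u + w) + B (u - w) (u - w) = 2 * B u u + 2 * B w w := by
  simp only [map_add, map_sub, LinearMap.add_apply, LinearMap.sub_apply]
  ring

/-- If the functions `Q_j : V → F` are linearly independent, the value vectors of all points span `Fʳ`. -/
theorem span_valueVec_eq_top_of_linearIndependent {V : Type*} {r : ℕ} (Q : Fin r → V → F)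
    (hQ : LinearIndependent F Q) : span F (Set.range (valueVec Q)) = ⊤ := by
  by_contra hne
  have hlt : span F (Set.range (valueVec Q)) < ⊤ := lt_top_iff_ne_top.2 hne
  obtain ⟨f, hf0, hker⟩ := Submodule.exists_le_ker_of_lt_top _ hlt
  -- the coefficients of `f` give a vanishing linear combination of the `Q_j`
  have hcomb : ∑ j, (f fun i => if j = i then 1 else 0) • Q j = 0 := by
    funext v
    have hv : f (valueVec Q v) = 0 := by
      have : valueVec Q v ∈ LinearMap.ker f := hker (subset_span ⟨v, rfl⟩)
      simpa using this
    rw [LinearMap.pi_apply_eq_sum_univ] at hv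
    simp only [Finset.sum_apply, Pi.smul_apply, smul_eq_mul, Pi.zero_apply]
    simpa [valueVec, mul_comm] using hv
  have hzero : ∀ j, (f fun i => if j = i then 1 else 0) = 0 :=
    Fintype.linearIndependent_iff.1 hQ _ hcomb
  apply hf0
  ext x
  have hx := hzero x
  have hfun : (fun i : Fin r => if x = i then (1 : F) else 0) = Pi.single x 1 := by
    funext i
    simp [Pi.single_apply, eq_comm]
  rw [hfun] at hx
  simpa using hx

/-- EXTENSION STEP.  A partial frame of `k < n ≤ r` vectors extends: some `w` lies outside `span(v_i)` with value
vector outside `span(value vectors of the v_i)`.  (Only the parallelogram law and `2 ≠ 0` are used.) -/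
theorem valueFrame_extend {n r k : ℕ} (Q : Fin r → (Fin n → F) → F) (h2 : (2 : F) ≠ 0)
    (hpar : ∀ j u w, Q j (u + w) + Q j (u - w) = 2 * Q j u + 2 * Q j w)
    (hspan : span F (Set.range (valueVec Q)) = ⊤) (hk : k < n) (hkr : k < r)
    (v : Fin k → (Fin n → F)) :
    ∃ w : Fin n → F, w ∉ span F (Set.range v) ∧
      valueVec Q w ∉ span F (Set.range (fun i => valueVec Q (v i))) := by
  by_contra hcon
  push Not at hcon
  set U : Submodule F (Fin n → F) := span F (Set.range v) with hU
  set L : Submodule F (Fin r → F) := span F (Set.range (fun i => valueVec Q (v i))) with hL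
  -- `U` is a proper subspace: `finrank U ≤ k < n`.
  have hUlt : ∃ w₀ : Fin n → F, w₀ ∉ U := by
    by_contra hall
    push Not at hall
    have hUtop : U = ⊤ := Submodule.eq_top_iff'.2 hall
    have h1 : Module.finrank F U ≤ k := by
      have := finrank_range_le_card (R := F) v
      simpa [Set.finrank] using this
    have h3 : Module.finrank F U = n := by rw [hUtop, finrank_top, Module.finrank_fin_fun]
    omega
  obtain ⟨w₀, hw₀⟩ := hUlt
  have hqw₀ : valueVec Q w₀ ∈ L := hcon w₀ hw₀
  -- every value vector lies in `L`
  have hall : ∀ u : Fin n → F, valueVec Q u ∈ L := by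
    intro u
    by_cases hu : u ∈ U
    · have h1 : u + w₀ ∉ U := fun h => hw₀ (by simpa using U.sub_mem h hu)
      have h1' : u - w₀ ∉ U := fun h => hw₀ (by simpa using U.sub_mem hu h)
      have e := valueVec_parallelogram Q hpar u w₀
      have h3 : (2 : F) • valueVec Q u ∈ L := by
        have : (2 : F) • valueVec Q u =
            valueVec Q (u + w₀) + valueVec Q (u - w₀) - (2 : F) • valueVec Q w₀ := by
          rw [e]; abel
        rw [this]
        exact L.sub_mem (L.add_mem (hcon _ h1) (hcon _ h1')) (L.smul_mem _ hqw₀)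
      have h4 : valueVec Q u = (2 : F)⁻¹ • ((2 : F) • valueVec Q u) := by
        rw [smul_smul, inv_mul_cancel₀ h2, one_smul]
      rw [h4]
      exact L.smul_mem _ h3
    · exact hcon u hu
  have hLtop : (⊤ : Submodule F (Fin r → F)) ≤ L := by
    rw [← hspan]
    exact span_le.2 (by rintro _ ⟨u, rfl⟩; exact hall u)
  have h5 : Module.finrank F (⊤ : Submodule F (Fin r → F)) ≤ Module.finrank F L :=
    Submodule.finrank_mono hLtop
  rw [finrank_top, Module.finrank_fin_fun] at h5
  have h6 : Module.finrank F L ≤ k := by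
    have := finrank_range_le_card (R := F) (fun i => valueVec Q (v i))
    simpa [Set.finrank] using this
  omega

/-- Greedy induction: partial value frames of every size `k ≤ n` exist. -/
theorem exists_valueFrame_aux {n r : ℕ} (Q : Fin r → (Fin n → F) → F) (h2 : (2 : F) ≠ 0)
    (hpar : ∀ j u w, Q j (u + w) + Q j (u - w) = 2 * Q j u + 2 * Q j w)
    (hspan : span F (Set.range (valueVec Q)) = ⊤) (hnr : n ≤ r) :
    ∀ k, k ≤ n → ∃ v : Fin k → (Fin n → F),
      LinearIndependent F v ∧ LinearIndependent F (fun i => valueVec Q (v i)) := by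
  intro k
  induction k with
  | zero =>
    intro _
    exact ⟨fun i => Fin.elim0 i, linearIndependent_empty_type, linearIndependent_empty_type⟩
  | succ k ih =>
    intro hk1
    obtain ⟨v, hv, hq⟩ := ih (Nat.le_of_succ_le hk1)
    obtain ⟨w, hwU, hwL⟩ := valueFrame_extend Q h2 hpar hspan (by omega) (by omega) v
    refine ⟨Fin.cons w v, hv.finCons hwU, ?_⟩
    have hc : (fun i => valueVec Q ((Fin.cons w v : Fin (k+1) → (Fin n → F)) i)) =
        Fin.cons (valueVec Q w) (fun i => valueVec Q (v i)) := by
      have := Fin.comp_cons (valueVec Q) w v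
      simpa [Function.comp_def] using this
    rw [hc]
    exact hq.finCons hwL

/-- THE VALUE-FRAME LEMMA (K3.14.2).  Let `Q_1, …, Q_r : Fⁿ → F` satisfy the parallelogram law (e.g. quadratic forms),
`2 ≠ 0` in `F`, `n ≤ r`, and suppose the value vectors of all points span `Fʳ` (e.g. the `Q_j` are linearly
independent functions).  Then there is a linearly independent `n`-family `v_1, …, v_n` — a frame — whose value vectors
`(Q_j(v_i))_j` are linearly independent.  Equivalently: the degree-2 part of the graded criterion can always be met. -/
theorem exists_valueFrame {n r : ℕ} (Q : Fin r → (Fin n → F) → F) (h2 : (2 : F) ≠ 0)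
    (hpar : ∀ j u w, Q j (u + w) + Q j (u - w) = 2 * Q j u + 2 * Q j w)
    (hspan : span F (Set.range (valueVec Q)) = ⊤) (hnr : n ≤ r) :
    ∃ v : Fin n → (Fin n → F),
      LinearIndependent F v ∧ LinearIndependent F (fun i => valueVec Q (v i)) :=
  exists_valueFrame_aux Q h2 hpar hspan hnr n le_rfl

/-- The frame of `exists_valueFrame` is a basis of `Fⁿ` (it spans). -/
theorem exists_valueFrame_span_top {n r : ℕ} (Q : Fin r → (Fin n → F) → F) (h2 : (2 : F) ≠ 0)
    (hpar : ∀ j u w, Q j (u + w) + Q j (u - w) = 2 * Q j u + 2 * Q j w)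
    (hspan : span F (Set.range (valueVec Q)) = ⊤) (hnr : n ≤ r) :
    ∃ v : Fin n → (Fin n → F), span F (Set.range v) = ⊤ ∧
      LinearIndependent F v ∧ LinearIndependent F (fun i => valueVec Q (v i)) := by
  obtain ⟨v, hv, hq⟩ := exists_valueFrame Q h2 hpar hspan hnr
  refine ⟨v, hv.span_eq_top_of_card_eq_finrank' (by simp), hv, hq⟩

/-- Version for linearly independent functions satisfying the parallelogram law (the form used in §7.14:
`W = span(Q_j)` of dimension `r ≥ n`). -/
theorem exists_valueFrame_of_linearIndependent {n r : ℕ} (Q : Fin r → (Fin n → F) → F) (h2 : (2 : F) ≠ 0)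
    (hpar : ∀ j u w, Q j (u + w) + Q j (u - w) = 2 * Q j u + 2 * Q j w)
    (hQ : LinearIndependent F Q) (hnr : n ≤ r) :
    ∃ v : Fin n → (Fin n → F), span F (Set.range v) = ⊤ ∧
      LinearIndependent F v ∧ LinearIndependent F (fun i => valueVec Q (v i)) :=
  exists_valueFrame_span_top Q h2 hpar (span_valueVec_eq_top_of_linearIndependent Q hQ) hnr

/-- Specialisation to `𝔽₃` and quadratic forms given by bilinear forms (the (K₃) setting): for `n ≤ r` linearly
independent quadratic forms `x ↦ B_j(x,x)` on `𝔽₃ⁿ` there is a frame with linearly independent value vectors. -/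
theorem exists_valueFrame_zmod3 {n r : ℕ} (B : Fin r → ((Fin n → ZMod 3) →ₗ[ZMod 3] (Fin n → ZMod 3) →ₗ[ZMod 3] ZMod 3))
    (hQ : LinearIndependent (ZMod 3) (fun j => fun x : Fin n → ZMod 3 => B j x x)) (hnr : n ≤ r) :
    ∃ v : Fin n → (Fin n → ZMod 3), span (ZMod 3) (Set.range v) = ⊤ ∧ LinearIndependent (ZMod 3) v ∧
      LinearIndependent (ZMod 3) (fun i => valueVec (fun j => fun x : Fin n → ZMod 3 => B j x x) (v i)) :=
  exists_valueFrame_of_linearIndependent _ (by decide) (fun j u w => parallelogram_of_bilin (B j) u w) hQ hnr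

end Summit.MatrixMultiplication.MatrixMultiplication.Theorems
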